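import Literature.AlgebraicGeometry.AbelianSchemes.EndomorphismStructureLocus
import HarnessLib

/-!
# A ring action on an abelian scheme from endomorphisms whose identities hold at ONE field point per connected component
# ([MumfordFogartyKirwan1994] Ch. 6 §1 Cor. 6.2 ∕ 6.4 rigidity; [Kottwitz1992] §5 p. 390)

Layer `Literature/AlgebraicGeometry/AbelianSchemes`, namespace `Literature.AlgebraicGeometry.AbelianSchemes.AbelianSchemeOver`.
THEOREMS ONLY (no definition, no named fact, no instance, no notation, no `sorry`).  Sequel of ★ (U1-a) `HomEqualityLocusClosed` and
★ (U1-b) `EndomorphismStructureLocus`.  Cell `hodgecm-mathlib` (D-0151), FLOOR 0, P6 «MOD programme» (crux hLiu418 = stmt-HodgeConjecture-24832,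
`--supports`), E-line `Cruxes/HLiu418/Lines/F0_P6a_PELWitnessE.lean` organ E6 `UnitaryCurvePELTuple` (A-p06 (g32) census
`CENSUS-E6-UnitaryCurvePELTuple.v1` §4 brick (B-α)).  HC_CM is proved only modulo the printed citations until rung 0 closes; this file is
generic and changes no count.

THE MATHEMATICS.  Let `S` be a locally Noetherian scheme and `f, g : A → B` homomorphisms of abelian schemes over `S`.  By rigidity
([MumfordFogartyKirwan1994] Ch. 6 §1 Cor. 6.2) the locus of points over which `f = g` on geometric fibres is a union of connected
components of `S` (★ `forall_pullback_map_eq_of_mem_connectedComponent`), and by its any-base form (★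
`hom_eq_of_forall_pullback_map_eq_of_isLocallyNoetherian_base`) agreement on all geometric fibres is agreement.  Hence the POINTWISE-TO-GLOBAL
PRINCIPLE used by every PEL construction ([Kottwitz1992] §5 p. 390; [RapoportSmithlingZhang2020Diagonal] §4.1): an identity between
homomorphisms of abelian schemes which holds after base change to ONE field-valued point in EVERY connected component of `S` holds over `S`.
Applied to the finitely many identities of an order action — multiplication table (E-M), unit (E-U), Rosati (E-R) of ★ (U1-b) — it turns
endomorphisms `y_1, …, y_n : A → A` whose identities are known FIBREWISE (e.g. read off period lattices at complex points, or off Tate modules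
at geometric points) into a ★ `RingAction O A` with `ι(b_j) = y_j` (★ `exists_ringAction_of_structureTable`) satisfying Rosati.

* §1 **`eq_of_forall_exists_fieldPoint`** — `f = g` as soon as every point of `S` has, in its connected component, the centre of a field point
  at which `f` and `g` agree after base change; `eq_of_fieldPoint_of_preconnectedSpace` (connected base, one point) is ★
  `eq_of_pullback_map_eq_of_preconnectedSpace` re-exported in the same letters; the finite-family form `forall_eq_of_forall_exists_fieldPoint`.
* §2 **`exists_ringAction_of_forall_exists_fieldPoint`** — (E-M)+(E-U) at one field point per connected component ⇒ a ring action extending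
  the `y_j`; `exists_ringAction_of_fieldPoint_of_preconnectedSpace` (connected base).
* §3 **`rosati_of_forall_exists_fieldPoint`** — (E-R) at one field point per connected component ⇒ (E-R) over `S`, for any homomorphism
  `lam : A → A′` and homomorphisms `yd_k : A′ → A′`; and the joint head **`exists_ringAction_rosati_of_forall_exists_fieldPoint`**.

## References
* [MumfordFogartyKirwan1994] D. Mumford, J. Fogarty, F. Kirwan, *Geometric Invariant Theory*, 3rd ed. (1994), Ch. 6 §1 Corollary 6.2 (p. 116),
  Corollary 6.4 (p. 117).
* [Kottwitz1992] R. Kottwitz, *Points on some Shimura varieties over finite fields*, JAMS 5 (1992), §5 (pp. 389–391).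
* [RapoportSmithlingZhang2020Diagonal] M. Rapoport, B. Smithling, W. Zhang, *Arithmetic diagonal cycles on unitary Shimura varieties*,
  Compositio 156 (2020), §4.1 (p. 17).
-/

set_option autoImplicit false

noncomputable section

universe u

open CategoryTheory CategoryTheory.Limits AlgebraicGeometry MonoidalCategory CartesianMonoidalCategory TopologicalSpace
open scoped MonObj

namespace Literature.AlgebraicGeometry.AbelianSchemes

namespace AbelianSchemeOver

/-! ## §1 The pointwise-to-global principle for an identity of homomorphisms -/

section OnePair

variable {S : Scheme.{u}} [IsLocallyNoetherian S] {A B : AbelianSchemeOver S} (f g : A.X ⟶ B.X) [IsMonHom f] [IsMonHom g]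

/-- **An identity of homomorphisms of abelian schemes which holds at one field-valued point in every connected component holds**
([MumfordFogartyKirwan1994] Ch. 6 §1 Cor. 6.2 ∕ 6.4): over a locally Noetherian `S`, if for every `x ∈ S` there is a field-valued point
`s : Spec K → S` centred in the connected component of `x` with `f ×_S s = g ×_S s`, then `f = g` (spread over the component by ★
`forall_pullback_map_eq_of_mem_connectedComponent`, conclude by the any-base rigidity ★ `hom_eq_of_forall_pullback_map_eq_of_isLocallyNoetherian_base`).
[cite: MumfordFogartyKirwan1994, Ch. 6 §1 Corollary 6.2 (p. 116) and Corollary 6.4 (p. 117)] [cite: Kottwitz1992, §5 (p. 390)] -/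
theorem eq_of_forall_exists_fieldPoint
    (h : ∀ x : S, ∃ (K : Type u) (_ : Field K) (s : Spec (.of K) ⟶ S),
      s.base (IsLocalRing.closedPoint K) ∈ connectedComponent x ∧ (Over.pullback s).map f = (Over.pullback s).map g) :
    f = g := by
  refine hom_eq_of_forall_pullback_map_eq_of_isLocallyNoetherian_base f g fun Ω _ _ t => ?_
  obtain ⟨K, _, s, hs, hfg⟩ := h (t.base (IsLocalRing.closedPoint Ω))
  have hx : t.base (IsLocalRing.closedPoint Ω) ∈ connectedComponent (s.base (IsLocalRing.closedPoint K)) := by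
    rw [← connectedComponent_eq hs]
    exact mem_connectedComponent
  exact forall_pullback_map_eq_of_mem_connectedComponent f g hx s rfl hfg t rfl

/-- **Connected base, one point** (★ `eq_of_pullback_map_eq_of_preconnectedSpace` in the letters of this file): over a preconnected locally
Noetherian `S`, agreement at ONE field-valued point is agreement. [cite: MumfordFogartyKirwan1994, Ch. 6 §1 Corollary 6.2 (p. 116)] -/
theorem eq_of_fieldPoint_of_preconnectedSpace [PreconnectedSpace S] {K : Type u} [Field K] (s : Spec (.of K) ⟶ S)
    (h : (Over.pullback s).map f = (Over.pullback s).map g) : f = g :=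
  eq_of_pullback_map_eq_of_preconnectedSpace f g s h

end OnePair

section Family

variable {S : Scheme.{u}} [IsLocallyNoetherian S] {J : Type*} {A B : J → AbelianSchemeOver S}
  (f g : ∀ j, (A j).X ⟶ (B j).X) [∀ j, IsMonHom (f j)] [∀ j, IsMonHom (g j)]

/-- **Finite or infinite families**: if for every `x ∈ S` ONE field point centred in the connected component of `x` satisfies ALL the
identities `f_j ×_S s = g_j ×_S s`, then `f_j = g_j` for all `j`. [cite: MumfordFogartyKirwan1994, Ch. 6 §1 Corollary 6.2 (p. 116) and Corollary 6.4 (p. 117)] -/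
theorem forall_eq_of_forall_exists_fieldPoint
    (h : ∀ x : S, ∃ (K : Type u) (_ : Field K) (s : Spec (.of K) ⟶ S),
      s.base (IsLocalRing.closedPoint K) ∈ connectedComponent x ∧ ∀ j, (Over.pullback s).map (f j) = (Over.pullback s).map (g j)) :
    ∀ j, f j = g j := by
  intro j
  refine eq_of_forall_exists_fieldPoint (f j) (g j) fun x => ?_
  obtain ⟨K, hK, s, hs, hfg⟩ := h x
  exact ⟨K, hK, s, hs, hfg j⟩

end Family

/-! ## §2 A ring action from the multiplication table and unit identity at one field point per connected component -/

section Action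

variable {S : Scheme.{u}} [IsLocallyNoetherian S] {A : AbelianSchemeOver S} [IsCommMonObj A.X] {O : Type*} [CommRing O] {n : ℕ}
  (bs : Module.Basis (Fin n) ℤ O) (y : Fin n → (A.X ⟶ A.X)) [∀ j, IsMonHom (y j)]

/-- **(E-M)+(E-U) pointwise ⇒ the ring action.**  Let `y₁, …, yₙ : A → A` be homomorphisms of a commutative abelian scheme over a locally
Noetherian `S`, `𝒪` an order with ℤ-basis `b`.  If every `x ∈ S` has a field-valued point `s` centred in its connected component at which,
after base change, the multiplication table `y_l ≫ y_k = ∏_j y_j^{(b_k b_l)_j}` and the unit identity `𝟙 = ∏_j y_j^{(1)_j}` hold, then they hold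
over `S` (§1) and `ι(Σ a_j b_j) := ∏_j y_j^{a_j}` is a ★ `RingAction 𝒪 A` with `ι(b_j) = y_j` (★ `exists_ringAction_of_structureTable`).
[cite: Kottwitz1992, §5 (pp. 389–390)] [cite: MumfordFogartyKirwan1994, Ch. 6 §1 Corollary 6.2 (p. 116) and Corollary 6.4 (p. 117)] -/
theorem exists_ringAction_of_forall_exists_fieldPoint
    (h : ∀ x : S, ∃ (K : Type u) (_ : Field K) (s : Spec (.of K) ⟶ S),
      s.base (IsLocalRing.closedPoint K) ∈ connectedComponent x ∧
        (∀ k l, (Over.pullback s).map (y l ≫ y k) = (Over.pullback s).map (∏ j, y j ^ (bs.repr (bs k * bs l) j))) ∧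
        (Over.pullback s).map (𝟙 A.X) = (Over.pullback s).map (∏ j, y j ^ (bs.repr 1 j))) :
    ∃ act : RingAction O A, ∀ j, act.i (bs j) = y j := by
  haveI : ∀ kl : Fin n × Fin n, IsMonHom (y kl.2 ≫ y kl.1) := fun kl => inferInstance
  haveI : ∀ kl : Fin n × Fin n, IsMonHom (∏ j, y j ^ (bs.repr (bs kl.1 * bs kl.2) j)) := fun kl =>
    isMonHom_finsetProd_zpow Finset.univ y _
  haveI : IsMonHom (∏ j, y j ^ (bs.repr (1 : O) j)) := isMonHom_finsetProd_zpow Finset.univ y _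
  have hM : ∀ kl : Fin n × Fin n, y kl.2 ≫ y kl.1 = ∏ j, y j ^ (bs.repr (bs kl.1 * bs kl.2) j) := by
    refine forall_eq_of_forall_exists_fieldPoint (A := fun _ => A) (B := fun _ => A)
      (fun kl : Fin n × Fin n => y kl.2 ≫ y kl.1) (fun kl => ∏ j, y j ^ (bs.repr (bs kl.1 * bs kl.2) j)) fun x => ?_
    obtain ⟨K, hK, s, hs, hm, -⟩ := h x
    exact ⟨K, hK, s, hs, fun kl => hm kl.1 kl.2⟩
  have hU : 𝟙 A.X = ∏ j, y j ^ (bs.repr (1 : O) j) := by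
    refine eq_of_forall_exists_fieldPoint (𝟙 A.X) (∏ j, y j ^ (bs.repr (1 : O) j)) fun x => ?_
    obtain ⟨K, hK, s, hs, -, hu⟩ := h x
    exact ⟨K, hK, s, hs, hu⟩
  exact exists_ringAction_of_structureTable bs y (fun k l => hM (k, l)) hU

/-- **Connected base, one point**: over a preconnected locally Noetherian `S`, (E-M)+(E-U) after base change to ONE field-valued point
give the ring action. [cite: Kottwitz1992, §5 (pp. 389–390)] [cite: MumfordFogartyKirwan1994, Ch. 6 §1 Corollary 6.2 (p. 116)] -/
theorem exists_ringAction_of_fieldPoint_of_preconnectedSpace [PreconnectedSpace S] {K : Type u} [Field K] (s : Spec (.of K) ⟶ S)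
    (hM : ∀ k l, (Over.pullback s).map (y l ≫ y k) = (Over.pullback s).map (∏ j, y j ^ (bs.repr (bs k * bs l) j)))
    (hU : (Over.pullback s).map (𝟙 A.X) = (Over.pullback s).map (∏ j, y j ^ (bs.repr 1 j))) :
    ∃ act : RingAction O A, ∀ j, act.i (bs j) = y j := by
  refine exists_ringAction_of_forall_exists_fieldPoint bs y fun x => ⟨K, inferInstance, s, ?_, hM, hU⟩
  rw [PreconnectedSpace.connectedComponent_eq_univ x]
  exact Set.mem_univ _

end Action

/-! ## §3 The Rosati identities from one field point per connected component; the joint head -/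

section Rosati

variable {S : Scheme.{u}} [IsLocallyNoetherian S] {A A' : AbelianSchemeOver S} [IsCommMonObj A.X] {n : ℕ}
  (y : Fin n → (A.X ⟶ A.X)) [∀ j, IsMonHom (y j)] (lam : A.X ⟶ A'.X) [IsMonHom lam]
  (yd : Fin n → (A'.X ⟶ A'.X)) [∀ k, IsMonHom (yd k)] (sm : Fin n → Fin n → ℤ)

/-- **(E-R) pointwise ⇒ (E-R).**  For homomorphisms `y_j : A → A` (commutative `A`), `lam : A → A′` (the polarization) and `yd_k : A′ → A′`
(the duals `y_k^∨`) and an integer matrix `sm` (the involution `b_k^* = Σ_j sm_{kj} b_j`): if every `x ∈ S` has a field-valued point centred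
in its connected component at which `(∏_j y_j^{sm_{kj}}) ≫ lam = lam ≫ yd_k` after base change for all `k`, then these Rosati identities hold
over `S`. [cite: Kottwitz1992, §5 (p. 390)] [cite: MumfordFogartyKirwan1994, Ch. 6 §1 Corollary 6.2 (p. 116) and Corollary 6.4 (p. 117)] -/
theorem rosati_of_forall_exists_fieldPoint
    (h : ∀ x : S, ∃ (K : Type u) (_ : Field K) (s : Spec (.of K) ⟶ S),
      s.base (IsLocalRing.closedPoint K) ∈ connectedComponent x ∧
        ∀ k, (Over.pullback s).map ((∏ j, y j ^ sm k j) ≫ lam) = (Over.pullback s).map (lam ≫ yd k)) :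
    ∀ k, (∏ j, y j ^ sm k j) ≫ lam = lam ≫ yd k := by
  haveI : ∀ k, IsMonHom ((∏ j, y j ^ sm k j) ≫ lam) := fun k => by
    haveI := isMonHom_finsetProd_zpow Finset.univ y (sm k)
    infer_instance
  exact forall_eq_of_forall_exists_fieldPoint (A := fun _ : Fin n => A) (B := fun _ => A')
    (fun k => (∏ j, y j ^ sm k j) ≫ lam) (fun k => lam ≫ yd k) h

variable {O : Type*} [CommRing O] (bs : Module.Basis (Fin n) ℤ O)

/-- **THE JOINT HEAD — ring action AND Rosati from one field point per connected component** (the PEL identities of [Kottwitz1992] §5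
read fibrewise): if every `x ∈ S` has a field-valued point centred in its connected component at which (E-M), (E-U) and (E-R) hold after base
change, then there is a ★ `RingAction 𝒪 A` with `ι(b_j) = y_j` and the Rosati identities `(∏_j y_j^{sm_{kj}}) ≫ lam = lam ≫ yd_k` hold over `S`.
[cite: Kottwitz1992, §5 (pp. 389–391)] [cite: MumfordFogartyKirwan1994, Ch. 6 §1 Corollary 6.2 (p. 116) and Corollary 6.4 (p. 117)] -/
theorem exists_ringAction_rosati_of_forall_exists_fieldPoint
    (h : ∀ x : S, ∃ (K : Type u) (_ : Field K) (s : Spec (.of K) ⟶ S),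
      s.base (IsLocalRing.closedPoint K) ∈ connectedComponent x ∧
        (∀ k l, (Over.pullback s).map (y l ≫ y k) = (Over.pullback s).map (∏ j, y j ^ (bs.repr (bs k * bs l) j))) ∧
        (Over.pullback s).map (𝟙 A.X) = (Over.pullback s).map (∏ j, y j ^ (bs.repr 1 j)) ∧
        ∀ k, (Over.pullback s).map ((∏ j, y j ^ sm k j) ≫ lam) = (Over.pullback s).map (lam ≫ yd k)) :
    (∃ act : RingAction O A, ∀ j, act.i (bs j) = y j) ∧ ∀ k, (∏ j, y j ^ sm k j) ≫ lam = lam ≫ yd k := by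
  refine ⟨exists_ringAction_of_forall_exists_fieldPoint bs y fun x => ?_, rosati_of_forall_exists_fieldPoint y lam yd sm fun x => ?_⟩
  · obtain ⟨K, hK, s, hs, hm, hu, -⟩ := h x
    exact ⟨K, hK, s, hs, hm, hu⟩
  · obtain ⟨K, hK, s, hs, -, -, hr⟩ := h x
    exact ⟨K, hK, s, hs, hr⟩

end Rosati

end AbelianSchemeOver

end Literature.AlgebraicGeometry.AbelianSchemes

end
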